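import Summits.AtomisticToContinuum.HydrodynamicLimit.Theorems.InformationPercolationEngineCollisionRatePreShockFrame
import HarnessLib

/-!
# Candidate ITEM TEXTS in the pre-shock, data-tied frame: the restated crux `CollisionRatePreShock` (R1) and its promoted kinetic core
# `EvenTubeTimeStatProbPreShock` (R2) — crux stmt-AtomisticToContinuum-13481 (`CollisionRate`), line `Sketch`

Lead c10 (prover-line-stmt-AtomisticToContinuum-13481-c10-0), 2026-08-17; tied-frame twin of c9's `PromotedT34pItem.lean`.  NOT a proposal: a
planner-facing, farm-checked rendering — every constant FULLY QUALIFIED, no `open`, no local notation, so that both texts elaborate standalone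
in any `Theses/` or `Theorems/` context — of

* `CollisionRatePreShock` — the crux RESTATED in the frame of its only consumer `ChaosClosesEuler` (classical hard-sphere Euler solution on
  `[0,T)`, packing guard at the same `η₀`, `t = 0` LLN, `τ < T`); token-identical (after unfolding the qualified names) to
  `Cruxes/CollisionRate/StrategistSketch.lean`'s `CollisionRatePreShock` (crux-strategist s1, recommendation R1) and to the conclusion ESO-ps of
  the landed `Theorems.CollisionRate.stub_evenStatOnePreShock_of_evenTubeTimeStatProbPreShock`;
* `EvenTubeTimeStatProbPreShock` — the line's kinetic core T34p with the same tied prefix (T34p-ps), the statement to PROMOTE (R2) if the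
  crux is restated.

The `example`s are kernel checks that (1) the restated crux follows from the existing crux `BGEndpointRigidity.LanfordEnvelopeR` (stmt-13677) and
the promoted core (RED′-ps `Theorems.CollisionRate.stub_evenStatOnePreShock_of_evenTubeTimeStatProbPreShock` through the bridge BR
`stub_marginalEnvelopeLG_of_lanfordEnvelopeR`, applied to the texts verbatim; in the tree also by name as
`Theorems.CollisionRate.evenStatOnePreShock_of_lanfordEnvelopeR_of_evenTubeTimeStatProbPreShock`, p141166), (2) given stmt-13677 the two texts are
EQUIVALENT (RED′-ps + NEC-ps; in the tree `evenStatOnePreShock_iff_evenTubeTimeStatProbPreShock_of_lanfordEnvelopeR`), (3) the filed crux implies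
the restated one (R1 is a weakening; in the tree `evenStatOnePreShock_of_collisionRate`) and (4) the filed crux with stmt-13677 implies the
promoted core (in the tree `evenTubeTimeStatProbPreShock_of_lanfordEnvelopeR_of_collisionRate`).  This file imports only the PSF module
(p140921) so that it elaborates on any farm snapshot that has it; the by-name forms live in `…CollisionRatePreShockEquivalence.lean` (p141166).
-/

namespace Summit.AtomisticToContinuum.HydrodynamicLimit.Cruxes.CollisionRate.PromotePreShock

/-- **The restated crux** (`CollisionRatePreShock`; informal: THE ENSKOG COLLISION-FREQUENCY LAW BEFORE THE SHOCK).  ∃ universal `η₀ > 0`;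
for continuous positive local-Gibbs profiles, `σ < σ₀(profiles)`, every classical hard-sphere Euler solution `(ρ, u, θ)` on `[0,T)` with
`ρ σ³ < η₀` on `[0,T)`, every flow family `Φ` whose local Gibbs laws satisfy the `t = 0` law of large numbers towards `(ρ, u, θ)`, every
horizon `0 < τ < T`, continuous localiser `χ`, continuous cutoff `g` vanishing on `[η₀, ∞)`, accuracies `η, δ > 0`: ∃ `r₀` ∀ `r < r₀` ∃ `N₀`
∀ `N ≥ N₀`, `P_LG(|evenStat σ N (Φ N) τ χ g 1 r| > η) ≤ δ` — the crux statistic `K_N[χ g(σ³ρ_r)] − σ³∫₀^τ∫ χ g Y(σ³ρ_r) B¹_r` in its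
`evenStat`-at-mark-`1` form (`Theorems.CollisionRate.collisionRate_iff_evenStat_one`).  Status: OPEN (Boltzmann–Enskog class) but rid of
the filed decl's post-shock `∀ τ` surplus; implied by the filed crux. [folklore] -/
def CollisionRatePreShock : Prop :=
  ∃ η₀ : ℝ, 0 < η₀ ∧ ∀ (a₀ θ₀ : Literature.MathematicalPhysics.KineticTheory.T3 → ℝ)
    (u₀ : Literature.MathematicalPhysics.KineticTheory.T3 → Literature.MathematicalPhysics.KineticTheory.V3),
    Continuous a₀ → Continuous θ₀ → Continuous u₀ → (∀ x, 0 < a₀ x) → (∀ x, 0 < θ₀ x) →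
    ∃ σ₀ : ℝ, 0 < σ₀ ∧ ∀ σ : ℝ, 0 < σ → σ < σ₀ →
    ∀ (T : ℝ) (ρ θ : ℝ → Literature.MathematicalPhysics.KineticTheory.T3 → ℝ)
      (u : ℝ → Literature.MathematicalPhysics.KineticTheory.T3 → Literature.MathematicalPhysics.KineticTheory.V3),
    Literature.MathematicalPhysics.KineticTheory.IsHardSphereEulerSolution σ T ρ u θ →
    (∀ t ∈ Set.Ico 0 T, ∀ x, ρ t x * σ ^ 3 < η₀) →
    ∀ Φ : (N : ℕ) → Literature.Analysis.FluidPDE.HardSphereFlow (Literature.Analysis.FluidPDE.Torus.geometry (Fin 3))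
      (Literature.MathematicalPhysics.KineticTheory.hsDiameter σ N) (N + 1),
    Literature.MathematicalPhysics.KineticTheory.TendstoHydroFieldsAt
      (fun N => Literature.MathematicalPhysics.KineticTheory.localGibbsLaw σ a₀ u₀ θ₀ N (Φ N)) Φ ρ u θ 0 →
    ∀ τ : ℝ, 0 < τ → τ < T → ∀ χ : ℝ × Literature.MathematicalPhysics.KineticTheory.T3 → ℝ, Continuous χ →
    ∀ g : ℝ → ℝ, Continuous g → (∀ a, η₀ ≤ a → g a = 0) →
    ∀ η δ : ℝ, 0 < η → 0 < δ → ∃ r₀ : ℝ, 0 < r₀ ∧ ∀ r : ℝ, 0 < r → r < r₀ →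
    ∃ N₀ : ℕ, ∀ N : ℕ, N₀ ≤ N →
      Literature.MathematicalPhysics.KineticTheory.localGibbsLaw σ a₀ u₀ θ₀ N (Φ N)
        {z | η < |Literature.MathematicalPhysics.KineticTheory.evenStat σ N (Φ N) τ χ g (fun _ => 1) r z|}
        ≤ ENNReal.ofReal δ

/-- **The promoted core in the tied frame** (`EvenTubeTimeStatProbPreShock`; informal: THE TIME-INTEGRATED BOLTZMANN CYLINDER AGAINST
ENSKOG'S PREDICTION, IN PROBABILITY, BEFORE THE SHOCK).  Same prefix as `CollisionRatePreShock`; conclusion: ∃ `r₀` ∀ `r < r₀` ∃ `L₀` ∀ `L ≥ L₀`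
∃ `κ₀` ∀ `κ < κ₀` ∃ `N₀` ∀ `N ≥ N₀`, `P_LG(|∫₀^τ W_t(Φ_t z) dt| > η) ≤ δ`, `W_t` the fixed-time even tube functional at the speed-truncated unit
mark `Ξ₁ᴸ` (Boltzmann's collision cylinder at flight-time resolution `κ ε_N` read on ONE configuration, minus `σ³ ×` Enskog's rate from the
SAME configuration's `r`-ball fields).  Status: OPEN (it is the restated crux given stmt-13677, by (2)); true at rung 0. [folklore] -/
def EvenTubeTimeStatProbPreShock : Prop :=
  ∃ η₀ : ℝ, 0 < η₀ ∧ ∀ (a₀ θ₀ : Literature.MathematicalPhysics.KineticTheory.T3 → ℝ)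
    (u₀ : Literature.MathematicalPhysics.KineticTheory.T3 → Literature.MathematicalPhysics.KineticTheory.V3),
    Continuous a₀ → Continuous θ₀ → Continuous u₀ → (∀ x, 0 < a₀ x) → (∀ x, 0 < θ₀ x) →
    ∃ σ₀ : ℝ, 0 < σ₀ ∧ ∀ σ : ℝ, 0 < σ → σ < σ₀ →
    ∀ (T : ℝ) (ρ θ : ℝ → Literature.MathematicalPhysics.KineticTheory.T3 → ℝ)
      (u : ℝ → Literature.MathematicalPhysics.KineticTheory.T3 → Literature.MathematicalPhysics.KineticTheory.V3),
    Literature.MathematicalPhysics.KineticTheory.IsHardSphereEulerSolution σ T ρ u θ →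
    (∀ t ∈ Set.Ico 0 T, ∀ x, ρ t x * σ ^ 3 < η₀) →
    ∀ Φ : (N : ℕ) → Literature.Analysis.FluidPDE.HardSphereFlow (Literature.Analysis.FluidPDE.Torus.geometry (Fin 3))
      (Literature.MathematicalPhysics.KineticTheory.hsDiameter σ N) (N + 1),
    Literature.MathematicalPhysics.KineticTheory.TendstoHydroFieldsAt
      (fun N => Literature.MathematicalPhysics.KineticTheory.localGibbsLaw σ a₀ u₀ θ₀ N (Φ N)) Φ ρ u θ 0 →
    ∀ τ : ℝ, 0 < τ → τ < T → ∀ χ : ℝ × Literature.MathematicalPhysics.KineticTheory.T3 → ℝ, Continuous χ →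
    ∀ g : ℝ → ℝ, Continuous g → (∀ x, η₀ ≤ x → g x = 0) →
    ∀ η δ : ℝ, 0 < η → 0 < δ → ∃ r₀ : ℝ, 0 < r₀ ∧ ∀ r : ℝ, 0 < r → r < r₀ →
    ∃ L₀ : ℝ, ∀ L : ℝ, L₀ ≤ L → ∃ κ₀ : ℝ, 0 < κ₀ ∧ ∀ κ : ℝ, 0 < κ → κ < κ₀ → ∃ N₀ : ℕ, ∀ N : ℕ, N₀ ≤ N →
      Literature.MathematicalPhysics.KineticTheory.localGibbsLaw σ a₀ u₀ θ₀ N (Φ N)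
        {z | η < |Literature.MathematicalPhysics.KineticTheory.evenTubeTimeStat σ N (Φ N) τ χ g
          (fun q : Literature.MathematicalPhysics.KineticTheory.V3 × Literature.MathematicalPhysics.KineticTheory.V3 ×
              Literature.MathematicalPhysics.KineticTheory.V3 =>
            Literature.MathematicalPhysics.KineticTheory.speedCutoff L ‖q.2.2 - q.2.1‖) r κ z|}
        ≤ ENNReal.ofReal δ

/-- (1) The restated crux from stmt-13677 and the promoted core — the texts are verbatim the hypothesis / conclusion of the tree transfer. -/
example (hE : Summit.AtomisticToContinuum.HydrodynamicLimit.Theses.BGEndpointRigidity.LanfordEnvelopeR)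
    (hT : EvenTubeTimeStatProbPreShock) : CollisionRatePreShock :=
  Summit.AtomisticToContinuum.HydrodynamicLimit.Theorems.CollisionRate.stub_evenStatOnePreShock_of_evenTubeTimeStatProbPreShock
    (Summit.AtomisticToContinuum.HydrodynamicLimit.Theorems.CollisionRate.stub_marginalEnvelopeLG_of_lanfordEnvelopeR hE) hT

/-- (2) Given stmt-13677 the restated crux and the promoted core are EQUIVALENT. -/
example (hE : Summit.AtomisticToContinuum.HydrodynamicLimit.Theses.BGEndpointRigidity.LanfordEnvelopeR) :
    CollisionRatePreShock ↔ EvenTubeTimeStatProbPreShock :=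
  ⟨Summit.AtomisticToContinuum.HydrodynamicLimit.Theorems.CollisionRate.stub_evenTubeTimeStatProbPreShock_of_evenStatOnePreShock
      (Summit.AtomisticToContinuum.HydrodynamicLimit.Theorems.CollisionRate.stub_marginalEnvelopeLG_of_lanfordEnvelopeR hE),
    Summit.AtomisticToContinuum.HydrodynamicLimit.Theorems.CollisionRate.stub_evenStatOnePreShock_of_evenTubeTimeStatProbPreShock
      (Summit.AtomisticToContinuum.HydrodynamicLimit.Theorems.CollisionRate.stub_marginalEnvelopeLG_of_lanfordEnvelopeR hE)⟩

/-- (3) R1 is a weakening: the filed crux implies the restated one (tree: `Theorems.CollisionRate.evenStatOnePreShock_of_collisionRate`). [folklore] -/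
theorem collisionRatePreShock_of_collisionRate
    (h : Summit.AtomisticToContinuum.HydrodynamicLimit.Theses.InformationPercolationEngine.CollisionRate) : CollisionRatePreShock := by
  rw [Summit.AtomisticToContinuum.HydrodynamicLimit.Theorems.CollisionRate.collisionRate_iff_evenStat_one] at h
  obtain ⟨η₀, hη₀, H⟩ := h
  refine ⟨η₀, hη₀, fun a₀ θ₀ u₀ ha hθ hu ha0 hθ0 => ?_⟩
  obtain ⟨σ₀, hσ₀, H⟩ := H a₀ θ₀ u₀ ha hθ hu ha0 hθ0
  refine ⟨σ₀, hσ₀, fun σ hσ hσlt T ρ θ u _ _ Φ _ τ hτ _ χ hχ g hg hg0 η δ hη hδ => ?_⟩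
  exact H σ hσ hσlt Φ τ hτ χ hχ g hg hg0 η δ hη hδ

/-- (4) The filed crux with stmt-13677 implies the promoted core. -/
example (hE : Summit.AtomisticToContinuum.HydrodynamicLimit.Theses.BGEndpointRigidity.LanfordEnvelopeR)
    (h : Summit.AtomisticToContinuum.HydrodynamicLimit.Theses.InformationPercolationEngine.CollisionRate) :
    EvenTubeTimeStatProbPreShock :=
  Summit.AtomisticToContinuum.HydrodynamicLimit.Theorems.CollisionRate.stub_evenTubeTimeStatProbPreShock_of_evenStatOnePreShock
    (Summit.AtomisticToContinuum.HydrodynamicLimit.Theorems.CollisionRate.stub_marginalEnvelopeLG_of_lanfordEnvelopeR hE) (collisionRatePreShock_of_collisionRate h)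

end Summit.AtomisticToContinuum.HydrodynamicLimit.Cruxes.CollisionRate.PromotePreShock
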